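import Summits.BirchSwinnertonDyer.BirchSwinnertonDyer.Theorems.SylvesterTwoHeegnerIndexUnramifiedQuadraticDescent
import Literature.NumberTheory.EllipticCurves.SelmerTorsionRestrictionJZero
import Literature.NumberTheory.EllipticCurves.SelmerTorsionCMOperatorJZero
import HarnessLib

/-!
# K7t crux `UpperOffV0HSYPlus` (item 19804), VARIANT K wrapper: LEMMA K0 for the FINITE-LEVEL
# SELMER GROUPS — `#Sel_{2^M}(E_K/K) = (#Sel_{2^M}(E/ℚ))²`, `Sel_{2^M}(E_K/K)` a `(ℤ/2^M)[ω]`-module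

Helper file of route `SylvesterTwoHeegnerIndex` (cell bsd-cm, rung K7t; hand-over of the K-ty
arithmetic-wrapper seat bsd-cm-k-ty1, to be FILED BY A PROVER SEAT). For `E = W/ℚ` elliptic with
`a₁ = a₂ = a₃ = a₄ = 0` (the cube-sum curves `E_p`, `E_{3p²}` after the stub's variable change),
`K` a totally complex quadratic number field with a primitive cube root of unity `ζ` (`K = ℚ(ω)`),
`σ ∈ Gal(K/ℚ)` with `σ ζ = ζ²`, `σ² = 1`, and `n = 2^M`:

* `exists_lemmaD_data_selmerGroup` — on `M := Sel_n(E_K/K)` (the tree's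
  `selmerGroup (W.baseChange K) n`) the CM operator `w = [ω]` (restriction of
  `JZero.exists_cm_operator_galH1Torsion`, file `SelmerTorsionCMOperatorJZero`) and the involution
  `s = σ_*` (restriction of the tree's `conjAct W σ n`, `conjAct_mem_selmerGroup`) satisfy
  `w² + w + 1 = 0`, `s² = 1`, `s w = w² s` (`s (w x) = −s x − w (s x)`), and `3` is bijective on `M`
  (`M` is killed by `2^M`: `zsmul_discreteH1_torsion`) — EXACTLY the hypotheses of LEMMA D
  (`SylvesterTwoUnramifiedDescent.descent_bijective`, `card_eq_card_invariants_sq`,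
  `mem_antiInvariants_iff`);
* `natCard_selmerGroup_baseChange_eq_sq` — **`#Sel_n(E_K/K) = (#Sel_n(E/ℚ))²`**: LEMMA D's
  `#M = (#M^{s})²` and `res : Sel_n(E/ℚ) ⥲ M^{s}` (`JZero.resTorsion_injective`,
  `JZero.existsUnique_resTorsion_eq_of_mem_selmerGroup`, file `SelmerTorsionRestrictionJZero`);
* `natCard_selmerGroup_baseChange_eq_sq_of_omega` — binder form on `⟨0, 0, 0, 0, b⟩` with only
  `ω² + ω + 1 = 0` and `finrank ℚ K = 2` (`JZero.exists_aut_apply_eq_sq`).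

This is the memo's «`Sel_{2^M}(X/K) = Sel_{2^M}(X/ℚ) ⊗_{ℤ₂} 𝒪₂/2^M`» (memo two §57.1, K3 proof) in
counted form. HONEST FRAMING: pure algebra/cohomology on the tree's objects; nothing about the SIZE
of any Selmer group, no Kolyvagin input, no `sorry`, no new definition or fact; BSD not claimed.

References: [GrossLMS1991] §5 (5.1)–(5.2); [SerreGaloisCohomology1997] I.§2.4, I.§5.8;
[MilneADT2006] I.§6; [SilvermanAEC2009] III.10.1, X.§4.
-/

set_option autoImplicit false
set_option linter.dupNamespace false

noncomputable section

open scoped Classical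
open WeierstrassCurve NumberField
open Literature.NumberTheory.EllipticCurves

namespace Summit.BirchSwinnertonDyer.BirchSwinnertonDyer.Theorems.SylvesterTwoSelmerDescentOrderForm

variable (W : WeierstrassCurve ℚ) [W.IsElliptic] (K : Type) [Field K] [NumberField K]
variable {σ : K ≃ₐ[ℚ] K}

/-- Restricting an endomorphism to a stable subgroup. [folklore] -/
private theorem exists_restrict {G : Type*} [AddCommGroup G] (f : G →+ G) (S : AddSubgroup G)
    (h : ∀ x ∈ S, f x ∈ S) : ∃ fS : S →+ S, ∀ x : S, ((fS x : S) : G) = f x :=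
  ⟨(f.comp S.subtype).codRestrict S fun x ↦ h x x.2, fun _ ↦ rfl⟩

/-- **LEMMA D data on `Sel_{2^M}(E_K/K)`.** For `E = W/ℚ` elliptic with `a₁ = … = a₄ = 0`, `K` a
totally complex number field with a primitive cube root of unity `ζ`, `σ ζ = ζ²`, `σ² = 1`: on
`M = selmerGroup (W.baseChange K) (2^M)` there are `w` (`= [ω]_*`) and `s` (`= σ_* = conjAct W σ`)
with `w² + w + 1 = 0`, `s² = 1`, `s (w x) = −s x − w (s x)`, and `x ↦ 3 • x` bijective — the
hypotheses of `SylvesterTwoUnramifiedDescent.descent_bijective` / `card_eq_card_invariants_sq` /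
`mem_antiInvariants_iff`. [cite: GrossLMS1991, §5 (5.1)]
[cite: SilvermanAEC2009, Thm. III.10.1 and Cor. III.10.2] -/
theorem exists_lemmaD_data_selmerGroup (hK : ∀ v : InfinitePlace K, v.IsComplex) (hσ2 : σ * σ = 1)
    (ha₁ : W.a₁ = 0) (ha₂ : W.a₂ = 0) (ha₃ : W.a₃ = 0) (ha₄ : W.a₄ = 0) {ζ : K}
    (hζ : IsPrimitiveRoot ζ 3) (hσζ : σ ζ = ζ ^ 2) (M : ℕ) :
    ∃ (w s : selmerGroup (W.baseChange K) ((2 ^ M : ℕ) : ℤ) →+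
        selmerGroup (W.baseChange K) ((2 ^ M : ℕ) : ℤ)),
      (∀ x, ((s x : selmerGroup (W.baseChange K) ((2 ^ M : ℕ) : ℤ)) :
          galH1Torsion (W.baseChange K) ((2 ^ M : ℕ) : ℤ)) =
        conjAct W σ ((2 ^ M : ℕ) : ℤ) x) ∧
      (∀ x, w (w x) + w x + x = 0) ∧ (∀ x, s (s x) = x) ∧ (∀ x, s (w x) = -(s x) - w (s x)) ∧
      Function.Bijective fun x : selmerGroup (W.baseChange K) ((2 ^ M : ℕ) : ℤ) =>
        (3 : ℤ) • x := by
  set n : ℤ := ((2 ^ M : ℕ) : ℤ) with hn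
  obtain ⟨_φ, w₀, -, -, -, hw₀, hSel, -, -, hsw₀⟩ :=
    JZero.exists_cm_operator_galH1Torsion K W ha₁ ha₂ ha₃ ha₄ hζ hσζ n
  obtain ⟨w, hw⟩ := exists_restrict w₀ (selmerGroup (W.baseChange K) n) hSel
  obtain ⟨s, hs⟩ := exists_restrict (conjAct W σ n) (selmerGroup (W.baseChange K) n)
    fun x hx ↦ conjAct_mem_selmerGroup W hK σ n hx
  refine ⟨w, s, hs, fun x ↦ ?_, fun x ↦ ?_, fun x ↦ ?_, ?_⟩
  · apply Subtype.ext
    rw [AddSubgroup.coe_add, AddSubgroup.coe_add, hw, hw, AddSubgroup.coe_zero]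
    exact hw₀ x
  · apply Subtype.ext
    rw [hs, hs]
    exact conjAct_conjAct_of_mul_self W hσ2 n x
  · apply Subtype.ext
    rw [hs, hw, AddSubgroup.coe_sub, AddSubgroup.coe_neg, hs, hw, hs]
    exact hsw₀ x
  · refine SylvesterTwoUnramifiedDescent.three_zsmul_bijective_of_two_primary fun x ↦ ⟨M, ?_⟩
    apply Subtype.ext
    rw [AddSubgroupClass.coe_zsmul, AddSubgroup.coe_zero]
    have h := zsmul_discreteH1_torsion n (x : galH1Torsion (W.baseChange K) n)
    have e : (2 : ℤ) ^ M = n := by simp [hn]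
    rw [e]
    exact h

/-- **LEMMA K0 for `Sel_{2^M}`: `#Sel_{2^M}(E_K/K) = (#Sel_{2^M}(E/ℚ))²`** (as `Nat.card`; both
sides `0` iff infinite). LEMMA D (`card_eq_card_invariants_sq`) on the data of
`exists_lemmaD_data_selmerGroup`, and the bijection `res : Sel_n(E/ℚ) ⥲ Sel_n(E_K/K)^{s}`
(`JZero.resTorsion_injective`, `JZero.existsUnique_resTorsion_eq_of_mem_selmerGroup`,
`conjAct_resTorsion`, `resTorsion_mem_selmerGroup`). [cite: GrossLMS1991, §5 (5.1)]
[cite: SerreGaloisCohomology1997, I.§2.4 (Prop. 9 and Cor.) and I.§5.8] -/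
theorem natCard_selmerGroup_baseChange_eq_sq (hK : ∀ v : InfinitePlace K, v.IsComplex)
    (hσ2 : σ * σ = 1) (ha₁ : W.a₁ = 0) (ha₂ : W.a₂ = 0) (ha₃ : W.a₃ = 0) (ha₄ : W.a₄ = 0)
    (h2 : Module.finrank ℚ K = 2) {ζ : K} (hζ : IsPrimitiveRoot ζ 3) (hσζ : σ ζ = ζ ^ 2) (M : ℕ) :
    Nat.card (selmerGroup (W.baseChange K) ((2 ^ M : ℕ) : ℤ)) =
      Nat.card (selmerGroup W ((2 ^ M : ℕ) : ℤ)) ^ 2 := by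
  set n : ℤ := ((2 ^ M : ℕ) : ℤ) with hn
  haveI : IsGalois ℚ K := by
    haveI : Algebra.IsQuadraticExtension ℚ K := ⟨h2⟩
    infer_instance
  have hσ1 : σ ≠ 1 := by
    intro h
    rw [h, AlgEquiv.one_apply] at hσζ
    have hζ0 : ζ ≠ 0 := hζ.ne_zero (by norm_num)
    have hζ1 : ζ ≠ 1 := hζ.ne_one (by norm_num)
    have : ζ * (ζ - 1) = 0 := by linear_combination hσζ.symm
    rcases mul_eq_zero.mp this with h0 | h0
    · exact hζ0 h0
    · exact hζ1 (sub_eq_zero.mp h0)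
  obtain ⟨w, s, hs, hw, hss, hsw, h3⟩ :=
    exists_lemmaD_data_selmerGroup W K hK hσ2 ha₁ ha₂ ha₃ ha₄ hζ hσζ M
  rw [SylvesterTwoUnramifiedDescent.card_eq_card_invariants_sq w s hw hss hsw h3]
  congr 1
  have hinj := JZero.resTorsion_injective K W n ha₁ ha₂ ha₃ ha₄ h2 hζ hσζ
  -- `r : Sel_n(E/ℚ) → M`, `r x = res x`
  let r : selmerGroup W n → selmerGroup (W.baseChange K) n :=
    fun x ↦ ⟨resTorsion W K n x, resTorsion_mem_selmerGroup W K n x.2⟩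
  have hr : ∀ x, ((r x : selmerGroup (W.baseChange K) n) : galH1Torsion (W.baseChange K) n) =
      resTorsion W K n x := fun _ ↦ rfl
  have hker : ∀ x, r x ∈ (s - AddMonoidHom.id _).ker := by
    intro x
    rw [AddMonoidHom.mem_ker, AddMonoidHom.sub_apply, AddMonoidHom.id_apply, sub_eq_zero]
    apply Subtype.ext
    rw [hs, hr]
    exact conjAct_resTorsion K W n σ h2 hσ1 _
  let r' : selmerGroup W n → (s - AddMonoidHom.id _).ker := fun x ↦ ⟨r x, hker x⟩
  symm
  refine Nat.card_congr (Equiv.ofBijective r' ⟨fun x y h ↦ ?_, ?_⟩)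
  · have h' : r x = r y := congrArg Subtype.val h
    have h'' : resTorsion W K n x = resTorsion W K n y := by rw [← hr, ← hr, h']
    exact Subtype.ext (hinj h'')
  · rintro ⟨y, hy⟩
    have hy' : conjAct W σ n (y : galH1Torsion (W.baseChange K) n) = y := by
      rw [AddMonoidHom.mem_ker, AddMonoidHom.sub_apply, AddMonoidHom.id_apply, sub_eq_zero] at hy
      rw [← hs, hy]
    obtain ⟨η, ⟨hη, hres⟩, -⟩ := JZero.existsUnique_resTorsion_eq_of_mem_selmerGroup K W n
      ha₁ ha₂ ha₃ ha₄ h2 hζ hσζ y.2 hy'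
    exact ⟨⟨η, hη⟩, Subtype.ext (Subtype.ext hres)⟩

/-- **`#Sel_{2^M}(⟨0,0,0,0,b⟩_K/K) = (#Sel_{2^M}(⟨0,0,0,0,b⟩/ℚ))²`, binder form**: `K` a number
field with `ω² + ω + 1 = 0` and `finrank ℚ K = 2` (then `K` is totally complex and `σ ω = ω²` for
the generator `σ`, `JZero.exists_aut_apply_eq_sq`); no side hypotheses. For the stubs' curves use
`C • X = HuShuYin2019.cubeSumCurve _ = ⟨0, 0, 0, 0, _⟩` and transport `Sel_n` along the variable
change (an isomorphism). [cite: GrossLMS1991, §5 (5.1)]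
[cite: SerreGaloisCohomology1997, I.§2.4 (Prop. 9 and Cor.) and I.§5.8] -/
theorem natCard_selmerGroup_baseChange_eq_sq_of_omega {b : ℚ}
    [(⟨0, 0, 0, 0, b⟩ : WeierstrassCurve ℚ).IsElliptic] {ω : K} (hω : ω ^ 2 + ω + 1 = 0)
    (h2 : Module.finrank ℚ K = 2) (M : ℕ) :
    Nat.card (selmerGroup ((⟨0, 0, 0, 0, b⟩ : WeierstrassCurve ℚ).baseChange K) ((2 ^ M : ℕ) : ℤ)) =
      Nat.card (selmerGroup (⟨0, 0, 0, 0, b⟩ : WeierstrassCurve ℚ) ((2 ^ M : ℕ) : ℤ)) ^ 2 := by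
  obtain ⟨hζ, hK, σ, hσζ, hσ2⟩ := JZero.exists_aut_apply_eq_sq K hω h2
  exact natCard_selmerGroup_baseChange_eq_sq ⟨0, 0, 0, 0, b⟩ K hK hσ2 rfl rfl rfl rfl h2 hζ hσζ M

end Summit.BirchSwinnertonDyer.BirchSwinnertonDyer.Theorems.SylvesterTwoSelmerDescentOrderForm

end
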